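import Summits.HodgeConjecture.HodgeConjecture.Theses.AnchorTransport
import Summits.HodgeConjecture.HodgeConjecture.Theorems.AnchorTransportVariationalHodgeReductions
import Summits.HodgeConjecture.HodgeConjecture.Theorems.AnchorTransportVariationalHodgeDominance
import Literature.AlgebraicGeometry.HodgeTheory.SemiregularityMapReal
import Literature.AlgebraicGeometry.HodgeTheory.ChernCharacterBetti
import Literature.AlgebraicGeometry.Modules.LinearOverBase
import Literature.AlgebraicGeometry.Modules.VectorBundleFiniteLocallyFree
import Literature.AlgebraicGeometry.ModuliOfSheaves.K3SheafModuli
import Literature.NumberTheory.Automorphic.ZariskiAffineSpace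
import Mathlib.AlgebraicGeometry.Morphisms.FinitePresentation
import Mathlib.AlgebraicGeometry.Noetherian
import Mathlib.Topology.JacobsonSpace
import HarnessLib

/-!
# Route AnchorTransport — `VariationalHodge` (stmt-HodgeConjecture-1076), line `exact-reduced-dimension-transport`: stub `stub_dominantFamilyTransport`

The registered stub `stub_dominantFamilyTransport` (= the typed statement `DominantFamilyTransport`
of the line skeleton `Cruxes/VariationalHodge/Lines/exact_reduced_dimension_transport.lean`), proved
unconditionally. **Chern characters along a dominant family of vector bundles make the classes
`A'_k` algebraic over a non-empty Zariski open of the base.** Let `f : 𝒳 ⟶ S` be a smooth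
projective family over a smooth irreducible affine `ℂ`-scheme `S`, `C` a Chern character theory on
the real Betti carrier (`HodgeTheory.ChernCharacterBetti`), `A'_k ∈ H²ᵏ(𝒳(ℂ); ℂ)` global classes,
and suppose given a DOMINANT family of vector bundles with Chern character `A'` in positive
degrees: an affine irreducible `ℂ`-scheme `T` locally of finite type, `h : T ⟶ S` with dense
image, and a finite locally free `ℰ` on `𝒳 ×_S T` with `ch_k(ℰ|_{(𝒳 ×_S T)_y}) = (pr_𝒳^* A'_k)|_y`
for every complex point `y` of `T` and every `k > 0`. Then there is a non-empty Zariski open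
`U ⊆ S` with `A'_k|_{𝒳_t}` algebraic for every complex point `t` over `U` and every `k > 0`.

Proof (as in the line's paper proof; no Hodge-theoretic input):
1. `h` is locally of finite type (cancellation in `T → S → Spec ℂ`), hence locally of finite
   presentation (`S` is locally Noetherian, being locally of finite type over `ℂ`), and
   quasi-compact (`T` quasi-compact, `S` affine); by **Chevalley's theorem** (Mathlib
   `Scheme.Hom.isConstructible_image`, EGA IV₁ 1.8.4, Stacks 054K) its image is constructible.
2. A dense constructible subset of an irreducible space contains a non-empty open subset
   (`Literature.NumberTheory.Automorphic.exists_isOpen_inter_closure_subset_of_isConstructible`: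
   a constructible set is a finite union of `Uᵢ ∖ Vᵢ` with `Uᵢ, Vᵢ` open, and the irreducible
   closure is the closure of one piece).
3. A complex point `t` of `S` over `U ⊆ h(T)` lifts to a complex point `y` of `T` with `h(y) = t`:
   the fibre `h⁻¹(pt t)` is a non-empty closed subset (`pt t` is a closed point) of the Jacobson
   space `T` (Mathlib `LocallyOfFiniteType.jacobsonSpace`, `nonempty_inter_closedPoints`), so it
   contains a closed point, which underlies a complex point (Nullstellensatz,
   `Motives.EsnaultLevineViehweg.exists_algPoints_pt_eq`); complex points with the same underlying
   point coincide (`Motives.ComplexPoints.equivClosedPoints`).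
4. `ch_k(ℰ|_y)` is an algebraic class on the smooth projective fibre `(𝒳 ×_S T)_y`
   (`ChernCharacterBetti.ch_mem_algebraicClasses`, the pull-back `ℰ|_y` being a vector bundle by
   `IsFiniteLocallyFree.pullback`), and it equals `(pr_𝒳^* A'_k)|_y` by hypothesis.
5. Algebraicity of fibre restrictions is invariant under base change
   (`Theorems.familyPullback_map_fiberι_mem_algebraicClasses_iff`), and `h(y) = t`.

## References

* A. Grothendieck, J. Dieudonné, EGA IV₁, Publ. Math. IHÉS 20 (1964), Thm. 1.8.4 (Chevalley).
* The Stacks Project, Tag 054K (Chevalley's theorem for morphisms of finite presentation).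
* W. Fulton, *Intersection Theory* (2nd ed. 1998), Prop. 19.1.2 (Chern classes of algebraic vector
  bundles act on algebraic cycles; algebraicity of `chᵢ(E)` on a non-singular variety).
-/

noncomputable section

set_option linter.dupNamespace false

open CategoryTheory CategoryTheory.Abelian AlgebraicGeometry CategoryTheory.Limits MonoidalCategory
open Literature.AlgebraicGeometry Literature.AlgebraicGeometry.Motives
  Literature.AlgebraicGeometry.HodgeTheory Literature.AlgebraicGeometry.Modules
  Literature.AlgebraicGeometry.ModuliOfSheaves
open _root_.Topology

namespace Summit.HodgeConjecture.HodgeConjecture.Theorems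

/-- **Stub `stub_dominantFamilyTransport` of line `exact-reduced-dimension-transport`** (the typed
statement `DominantFamilyTransport`): for a smooth projective family `f : 𝒳 ⟶ S` of relative
dimension `n` over a smooth irreducible affine `ℂ`-scheme `S`, a Chern character theory `C`, global
classes `A'_k ∈ H²ᵏ(𝒳(ℂ); ℂ)`, and a dominant family of vector bundles realising `A'` in positive
degrees — `T` affine irreducible locally of finite type over `ℂ`, `h : T ⟶ S` with dense image, `ℰ`
finite locally free on `𝒳 ×_S T` with `ch_k(ℰ|_y) = (pr_𝒳^* A'_k)|_y` on the fibre of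
`𝒳 ×_S T → T` at every complex point `y` of `T`, all `k > 0` — there is a non-empty Zariski open
`U ⊆ S` such that `A'_k|_{𝒳_t} ∈ Nᵏ H²ᵏ(𝒳_t(ℂ); ℂ)` is algebraic for every complex point `t` of `S`
over `U` and every `k > 0`. Proof: the image of `h` is constructible (Chevalley: `h` is of finite
presentation, `S` being Noetherian affine) and dense, so it contains a non-empty open `U` of the
irreducible `S`; a complex point `t` over `U` lifts to a complex point `y` of `T` (closed points of
the non-empty closed fibre of the Jacobson scheme `T` are complex points, Nullstellensatz);
`ch_k(ℰ|_y)` is algebraic on the smooth projective fibre (Fulton, Prop. 19.1.2, the field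
`ChernCharacterBetti.ch_mem_algebraicClasses`) and equals `(pr_𝒳^* A'_k)|_y`, whose algebraicity is
that of `A'_k|_{𝒳_t}` (`familyPullback_map_fiberι_mem_algebraicClasses_iff`).
[cite: EGA0IV, Ch. IV Thm. 1.8.4 (Chevalley)] [cite: StacksProject, Tag 054K]
[cite: Fulton1998, Prop. 19.1.2] -/
theorem stub_dominantFamilyTransport :
    ∀ ⦃n : ℕ⦄ ⦃𝒳 S : SchemeOver ℂ⦄ (f : 𝒳 ⟶ S), IsSmoothProjectiveFamily f n →
      IrreducibleSpace S.left → IsAffine S.left → AlgebraicGeometry.Smooth S.hom →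
      ∀ (C : ChernCharacterBetti) (A' : (k : ℕ) → complexBetti 𝒳 (2 * k)),
      (∃ (T : SchemeOver ℂ) (h : T ⟶ S) (ℰ : (familyPullback f h).left.Modules),
        IsAffine T.left ∧ IrreducibleSpace T.left ∧ LocallyOfFiniteType T.hom ∧
        Dense (Set.range h.left.base) ∧ IsFiniteLocallyFree ℰ ∧
        ∀ (y : ComplexPoints T) (k : ℕ), 0 < k →
          C.ch (fiberOver (familyPullback.snd f h) y)
            ((Scheme.Modules.pullback (fiberι (familyPullback.snd f h) y).left).obj ℰ) k =
          complexBetti.map (fiberι (familyPullback.snd f h) y) (2 * k)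
            (complexBetti.map (familyPullback.fst f h) (2 * k) (A' k))) →
      ∃ U : Set S.left, IsOpen U ∧ U.Nonempty ∧
        ∀ t : ComplexPoints S, t.pt ∈ U → ∀ k : ℕ, 0 < k →
          complexBetti.map (fiberι f t) (2 * k) (A' k) ∈ algebraicClasses (fiberOver f t) k := by
  intro n 𝒳 S f hf hirr haff hsm C A' hfam
  obtain ⟨T, h, ℰ, hTaff, hTirr, hTlft, hdense, hℰ, hch⟩ := hfam
  haveI := hirr
  haveI := haff
  haveI := hsm
  haveI := hTaff
  haveI := hTirr
  haveI := hTlft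
  -- (1) finiteness bookkeeping: `S` is locally Noetherian; `h` is locally of finite type
  -- (cancellation), hence locally of finite presentation, and quasi-compact (`T` compact, `S` affine)
  haveI : IsLocallyNoetherian S.left := LocallyOfFiniteType.isLocallyNoetherian S.hom
  haveI : LocallyOfFiniteType h.left := by
    have hw : h.left ≫ S.hom = T.hom := Over.w h
    haveI : LocallyOfFiniteType (h.left ≫ S.hom) := by rw [hw]; infer_instance
    exact locallyOfFiniteType_of_comp h.left S.hom
  haveI : LocallyOfFinitePresentation h.left := inferInstance
  haveI : QuasiCompact h.left := inferInstance
  -- Chevalley: the image of `h` is constructible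
  have hcons : IsConstructible (Set.range h.left.base) := by
    have himg := h.left.isConstructible_image IsConstructible.univ
    rwa [Set.image_univ] at himg
  -- (2) a dense constructible subset of the irreducible `S` contains a non-empty open `U`
  have hcl : closure (Set.range h.left.base) = Set.univ := hdense.closure_eq
  obtain ⟨U, hU, hUne, hUsub⟩ :=
    Literature.NumberTheory.Automorphic.exists_isOpen_inter_closure_subset_of_isConstructible hcons
      (by rw [hcl]; exact IrreducibleSpace.isIrreducible_univ _)
  rw [hcl, Set.inter_univ] at hUne hUsub
  refine ⟨U, hU, hUne, fun t ht k hk => ?_⟩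
  -- (3) lift `t` to a complex point `y` of `T` with `h y = t`: the closed non-empty fibre of the
  -- Jacobson space `T` over the closed point `pt t` contains a closed point, i.e. a complex point
  obtain ⟨x, hx⟩ := hUsub ht
  haveI : JacobsonSpace T.left := LocallyOfFiniteType.jacobsonSpace T.hom
  have hfib : IsClosed (h.left.base ⁻¹' ({t.pt} : Set S.left)) :=
    (ComplexPoints.isClosed_pt t).preimage h.left.continuous
  obtain ⟨q, hq, hqc⟩ := nonempty_inter_closedPoints (X := ↥T.left) ⟨x, hx⟩ hfib.isLocallyClosed
  obtain ⟨y, hy⟩ := EsnaultLevineViehweg.exists_algPoints_pt_eq (X := T) (k := ℂ) hqc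
  obtain rfl : AlgPoints.map h y = t := by
    apply (ComplexPoints.equivClosedPoints S).injective
    apply Subtype.ext
    rw [ComplexPoints.coe_equivClosedPoints_apply, ComplexPoints.coe_equivClosedPoints_apply,
      AlgPoints.pt_map, hy]
    exact Set.mem_singleton_iff.mp (Set.mem_preimage.mp hq)
  -- (4) `ch_k(ℰ|_y)` is algebraic on the smooth projective fibre of the base-changed family and
  -- equals `(pr_𝒳^* A'_k)|_y`
  have halg := C.ch_mem_algebraicClasses ((hf.familyPullback_snd h).isSmoothProjective y)
    ((Scheme.Modules.pullback (fiberι (familyPullback.snd f h) y).left).obj ℰ)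
    ((hℰ.pullback _).isVectorBundle) k
  rw [hch y k hk] at halg
  -- (5) base-change invariance of algebraicity, at `h y = t`
  exact (familyPullback_map_fiberι_mem_algebraicClasses_iff f h hf (A' k) y).1 halg

end Summit.HodgeConjecture.HodgeConjecture.Theorems

end
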